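import Literature.Analysis.Calculus.SmoothCutoff
import Literature.Analysis.FluidPDE.NavierStokesReynoldsSteps
import HarnessLib

/-!
# Tools for the Cheskidov–Luo concentration step: tensor calculus, temporal cut-offs, the grid

Support file (all results proved; definitions are elementary constructions) for the proof of
Cheskidov–Luo 2022, Prop. 3.1 (`Torus.CheskidovLuo2022Concentration`, file
`NavierStokesReynoldsSteps`) from the corrector fact `Torus.CheskidovLuo2022Corrector` (file
`NavierStokesConcentrationCorrector`), carried out in `NavierStokesConcentrationGlue`
(the glued triple, Prop. 3.3) and `NavierStokesConcentration` (Prop. 3.1). A. Cheskidov, X. Luo,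
*Sharp nonuniqueness for the Navier–Stokes equations*, Invent. Math. 229 (2022) = arXiv:2009.06596,
§3 (numbering of the held arXiv copy).

## Contents

* `section TensorCalculus` (namespace `Torus`): additivity of the torus operators `Δ`, `(u·∇)`,
  `∇`, `div` on smooth fields, of `IsDivFree` and `HasZeroMean`; the tensor product
  `Torus.tensorProd v w` (by columns, as the stress of `Torus.IsNSReynoldsOn`) and the trace-free
  square `Torus.tracelessSq v = v ⊗̊ v` (CL22, §3.2), with `div (v ⊗ w) = (w·∇)v + (div w) v`,
  `div (f Id) = ∇f`, `div (v ⊗̊ v) = (v·∇)v - ∇(|v|²/d)` for divergence-free `v`, symmetry,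
  trace, the pointwise bound `‖v ⊗̊ v‖ ≤ 2‖v‖²`.
* `section TimeCutoff`: `Torus.IsTimeCutoff S a b χ` — admissible temporal cut-offs for a field
  living on `[a, b]` relative to a longer time set `S` (CL22, §3.2: `χᵢ` vanishes near the ends
  of `[tᵢ, tᵢ₊₁]` except at `t = 0`, `t = 1`); gluing preserves joint smoothness
  (`IsTimeCutoff.isSmoothSpaceTimeOn_smul`), the product rule within `S`
  (`IsTimeCutoff.hasDerivWithinAt_smul`); smoothness in time of space integrals
  (`IsSmoothSpaceTimeOn.contDiffOn_integral`, used for the pressure normalisation).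
* `section Grid` (namespace `Torus.Concentration`): the constant `cutoffDerivBound = M_S ≥ 1`
  bounding `|S'|` for Mathlib's `Real.smoothTransition` (from
  `Literature.Analysis.Calculus.exists_bound_deriv_smoothTransition`); the nodes
  `node T n i = iT/n` and the cut-offs `cutoff T n τ i = χᵢ` of CL22, (3.3)–(3.5) (transition
  length `τ/4`), with plateau/vanishing/derivative (`|χᵢ'| ≤ 8M_S/τ`) lemmas, disjointness of
  supports, `∑χᵢ ≤ 1`, localisation to the grid interval, `exists_mem_Icc_node`, and
  `isTimeCutoff_cutoff`.

## Mathlib / tree search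

Reused, not restated: `FunctionSpaces.Torus.{fderiv_add, fderiv_const_smul, partialDeriv_add,
partialDeriv_smul, gradient_eq_sum_partialDeriv, fderiv_apply_eq_sum_partialDeriv}`,
`Torus.gradient_const_smul`, `Torus.tensorDivergence_const_smul` (`EulerReynolds`),
`Torus.laplacian_const_smul'`, `Torus.hasZeroMean_const_smul`, `Torus.isDivFree_const_smul`
(`TorusForceBookkeeping`), `IsSmoothSpaceTimeOn.{hasDerivWithinAt_slice,
hasDerivWithinAt_integral, timeDerivWithin}`, and the smooth-transition derivative facts of
`Literature.Analysis.Calculus.SmoothCutoff` (`differentiable_smoothTransition`,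
`exists_bound_deriv_smoothTransition`; `lean search 'smoothTransitionDerivBound'` also finds
problem-specific copies in `SwirlCutoff`, `CollarUniquenessBall`, not imported here). Mathlib:
`ContDiffAt.laplacian_add`, `contDiffOn_of_locally_contDiffOn`, `contDiffOn_succ_iff_derivWithin`,
`Real.smoothTransition`. The additivity lemmas for `Δ`, `(u·∇)`, `∇`, `div` have relatives in
files outside this import closure (`LerayHopfTimeSliceTorus`, `NSHopfGalerkinLimit`,
`TorusFourierConvolution`); `tracelessSq`, `IsTimeCutoff`, `node`, `cutoff` are new
(`lean search 'tracelessSq|IsTimeCutoff|def node |def cutoff '`).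

## References

* A. Cheskidov, X. Luo, *Sharp nonuniqueness for the Navier–Stokes equations*, Invent. Math. 229
  (2022), 987–1054; arXiv:2009.06596: §2.1, §3.1, §3.2 (3.3)–(3.6), §3.3. [`CheskidovLuo2022`]
-/

open MeasureTheory Set Filter Topology
open scoped InnerProductSpace ContDiff ENNReal NNReal

noncomputable section

namespace Literature.Analysis.FluidPDE

namespace Torus

section TensorCalculus

open FunctionSpaces.Torus

variable {d : Type*} [Fintype d] [DecidableEq d]
variable {F : Type*} [NormedAddCommGroup F] [NormedSpace ℝ F]

/-! ## Linearity of the torus operators on smooth fields -/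

section Linear

omit [DecidableEq d] in
/-- `Δ(f + g) = Δf + Δg` for smooth functions on the torus. [folklore] -/
theorem laplacian_add_apply {f g : UnitAddTorus d → F} (hf : IsSmooth f) (hg : IsSmooth g)
    (x : UnitAddTorus d) :
    FunctionSpaces.Torus.laplacian (fun y => f y + g y) x = FunctionSpaces.Torus.laplacian f x + FunctionSpaces.Torus.laplacian g x := by
  rw [FunctionSpaces.Torus.laplacian, FunctionSpaces.Torus.laplacian, FunctionSpaces.Torus.laplacian,
    show liftAt (fun y => f y + g y) x = liftAt f x + liftAt g x from rfl]
  rw [((hf.isContDiff (n := 2) (WithTop.coe_le_coe.mpr le_top)).liftAt x).contDiffAt.laplacian_add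
    ((hg.isContDiff (n := 2) (WithTop.coe_le_coe.mpr le_top)).liftAt x).contDiffAt]

omit [Fintype d] [DecidableEq d] in
/-- The convective derivative is additive in the transporting field (no regularity needed). [folklore] -/
theorem convect_add_left (u₁ u₂ : UnitAddTorus d → EuclideanSpace ℝ d) (v : UnitAddTorus d → F)
    (x : UnitAddTorus d) :
    FunctionSpaces.Torus.convect (fun y => u₁ y + u₂ y) v x = FunctionSpaces.Torus.convect u₁ v x + FunctionSpaces.Torus.convect u₂ v x := by
  simp [FunctionSpaces.Torus.convect]

omit [Fintype d] [DecidableEq d] in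
/-- The convective derivative is homogeneous in the transporting field. [folklore] -/
theorem convect_smul_left (c : ℝ) (u : UnitAddTorus d → EuclideanSpace ℝ d) (v : UnitAddTorus d → F)
    (x : UnitAddTorus d) :
    FunctionSpaces.Torus.convect (fun y => c • u y) v x = c • FunctionSpaces.Torus.convect u v x := by
  simp [FunctionSpaces.Torus.convect]

omit [DecidableEq d] in
/-- The convective derivative is additive in the transported field (`C¹`). [folklore] -/
theorem convect_add_right (u : UnitAddTorus d → EuclideanSpace ℝ d) {v w : UnitAddTorus d → F}
    (hv : IsContDiff 1 v) (hw : IsContDiff 1 w) (x : UnitAddTorus d) :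
    FunctionSpaces.Torus.convect u (fun y => v y + w y) x = FunctionSpaces.Torus.convect u v x + FunctionSpaces.Torus.convect u w x := by
  simp only [FunctionSpaces.Torus.convect]
  rw [show (fun y => v y + w y) = v + w from rfl, FunctionSpaces.Torus.fderiv_add hv hw]
  rfl

omit [DecidableEq d] in
/-- The convective derivative is homogeneous in the transported field (`C¹`). [folklore] -/
theorem convect_smul_right (u : UnitAddTorus d → EuclideanSpace ℝ d) {v : UnitAddTorus d → F}
    (hv : IsContDiff 1 v) (c : ℝ) (x : UnitAddTorus d) :
    FunctionSpaces.Torus.convect u (fun y => c • v y) x = c • FunctionSpaces.Torus.convect u v x := by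
  simp only [FunctionSpaces.Torus.convect]
  rw [show (fun y => c • v y) = c • v from rfl, FunctionSpaces.Torus.fderiv_const_smul hv]
  rfl

omit [DecidableEq d] in
/-- The gradient is additive (`C¹` scalars). [folklore] -/
theorem gradient_add_apply {θ φ : UnitAddTorus d → ℝ} (hθ : IsContDiff 1 θ) (hφ : IsContDiff 1 φ)
    (x : UnitAddTorus d) :
    FunctionSpaces.Torus.gradient (fun y => θ y + φ y) x = FunctionSpaces.Torus.gradient θ x + FunctionSpaces.Torus.gradient φ x := by
  refine ext_inner_right ℝ fun w => ?_
  rw [inner_add_left, FunctionSpaces.Torus.inner_gradient_left, FunctionSpaces.Torus.inner_gradient_left,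
    FunctionSpaces.Torus.inner_gradient_left,
    show (fun y => θ y + φ y) = θ + φ from rfl, FunctionSpaces.Torus.fderiv_add hθ hφ]
  rfl

omit [DecidableEq d] in
/-- The gradient is homogeneous (`C¹` scalars). [folklore] -/
theorem gradient_const_mul_apply {θ : UnitAddTorus d → ℝ} (hθ : IsContDiff 1 θ) (c : ℝ)
    (x : UnitAddTorus d) :
    FunctionSpaces.Torus.gradient (fun y => c * θ y) x = c • FunctionSpaces.Torus.gradient θ x := by
  rw [show (fun y => c * θ y) = c • θ from rfl]
  exact gradient_const_smul hθ c x

omit [DecidableEq d] in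
/-- The gradient of a constant vanishes. [folklore] -/
theorem gradient_const (c : ℝ) (x : UnitAddTorus d) :
    FunctionSpaces.Torus.gradient (fun _ : UnitAddTorus d => c) x = 0 := by
  unfold FunctionSpaces.Torus.gradient liftAt
  simp [_root_.gradient]

/-- The divergence is additive (`C¹` fields). [folklore] -/
theorem divergence_add_apply {u v : UnitAddTorus d → EuclideanSpace ℝ d} (hu : IsContDiff 1 u)
    (hv : IsContDiff 1 v) (x : UnitAddTorus d) :
    FunctionSpaces.Torus.divergence (fun y => u y + v y) x = FunctionSpaces.Torus.divergence u x + FunctionSpaces.Torus.divergence v x := by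
  unfold FunctionSpaces.Torus.divergence
  rw [← Finset.sum_add_distrib]
  refine Finset.sum_congr rfl fun i _ => ?_
  have hui : IsContDiff 1 (fun y => u y i) :=
    (EuclideanSpace.proj i : EuclideanSpace ℝ d →L[ℝ] ℝ).contDiff.comp hu
  have hvi : IsContDiff 1 (fun y => v y i) :=
    (EuclideanSpace.proj i : EuclideanSpace ℝ d →L[ℝ] ℝ).contDiff.comp hv
  have h : (fun y => (u y + v y) i) = (fun y => u y i) + fun y => v y i := by
    funext y; simp
  rw [h, FunctionSpaces.Torus.partialDeriv_add hui hvi]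
  rfl

/-- Sums of divergence-free `C¹` fields are divergence free. [folklore] -/
theorem _root_.Literature.Analysis.FunctionSpaces.Torus.IsDivFree.add {u v : UnitAddTorus d → EuclideanSpace ℝ d} (hu : IsContDiff 1 u)
    (hv : IsContDiff 1 v) (hud : FunctionSpaces.Torus.IsDivFree u) (hvd : FunctionSpaces.Torus.IsDivFree v) :
    FunctionSpaces.Torus.IsDivFree (fun y => u y + v y) := fun x => by
  rw [divergence_add_apply hu hv, hud x, hvd x, add_zero]

omit [DecidableEq d] in
/-- Sums of zero-mean integrable functions have zero mean. [folklore] -/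
theorem _root_.Literature.Analysis.FunctionSpaces.Torus.HasZeroMean.add {f g : UnitAddTorus d → F} (hf : FunctionSpaces.Torus.HasZeroMean f) (hg : FunctionSpaces.Torus.HasZeroMean g)
    (hfi : Integrable f volume) (hgi : Integrable g volume) :
    FunctionSpaces.Torus.HasZeroMean (fun y => f y + g y) := by
  unfold FunctionSpaces.Torus.HasZeroMean at hf hg ⊢
  rw [integral_add hfi hgi, hf, hg, add_zero]

omit [DecidableEq d] in
/-- Differences of zero-mean integrable functions have zero mean. [folklore] -/
theorem _root_.Literature.Analysis.FunctionSpaces.Torus.HasZeroMean.sub {f g : UnitAddTorus d → F}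
    (hf : FunctionSpaces.Torus.HasZeroMean f) (hg : FunctionSpaces.Torus.HasZeroMean g)
    (hfi : Integrable f volume) (hgi : Integrable g volume) :
    FunctionSpaces.Torus.HasZeroMean (fun y => f y - g y) := by
  unfold FunctionSpaces.Torus.HasZeroMean at hf hg ⊢
  rw [integral_sub hfi hgi, hf, hg, sub_zero]

omit [DecidableEq d] in
/-- A function minus its mean has zero mean (probability torus). [folklore] -/
theorem hasZeroMean_sub_integral [CompleteSpace F] {f : UnitAddTorus d → F} (hfi : Integrable f volume) :
    FunctionSpaces.Torus.HasZeroMean (fun y => f y - ∫ z, f z) := by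
  unfold FunctionSpaces.Torus.HasZeroMean
  rw [integral_sub hfi (integrable_const _), integral_const]
  simp

end Linear

/-! ## Tensor products of vector fields and their divergence -/

section Tensor

/-- The tensor product `v ⊗ w` of two vector fields on `𝕋^d`, stored by columns:
`(v ⊗ w) y j = w y j • v y`, i.e. the `(i, j)` entry is `vᵢ wⱼ`, so that
`div (v ⊗ w)ᵢ = ∑ⱼ ∂ⱼ (vᵢ wⱼ)` (CL22, §2.1: "`div(u ⊗ u)`"; BDSV 2019, §2.1). [cite: CheskidovLuo2022, §2.1] -/
def tensorProd (v w : UnitAddTorus d → EuclideanSpace ℝ d) : UnitAddTorus d → d → EuclideanSpace ℝ d :=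
  fun y j => w y j • v y

/-- The trace-free part of `v ⊗ v`: `v ⊗̊ v = v ⊗ v - (|v|²/d) Id`, by columns
`(v ⊗̊ v) y j = v y j • v y - (‖v y‖² / d) • eⱼ` (CL22, §3.2: "`f ⊗̊ g = fᵢgⱼ - δᵢⱼ fₖgₖ/d`"). [cite: CheskidovLuo2022, §3.2] -/
def tracelessSq (v : UnitAddTorus d → EuclideanSpace ℝ d) : UnitAddTorus d → d → EuclideanSpace ℝ d :=
  fun y j => v y j • v y - (‖v y‖ ^ 2 / Fintype.card d) • EuclideanSpace.single j 1

omit [Fintype d] [DecidableEq d] in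
/-- Entries of `v ⊗ w`: `(v ⊗ w)ᵢⱼ = vᵢ wⱼ`. [folklore] -/
@[simp]
theorem tensorProd_apply (v w : UnitAddTorus d → EuclideanSpace ℝ d) (y : UnitAddTorus d) (i j : d) :
    tensorProd v w y j i = v y i * w y j := by
  simp [tensorProd, mul_comm]

/-- Entries of `v ⊗̊ v`: `vᵢvⱼ - δᵢⱼ|v|²/d`. [folklore] -/
theorem tracelessSq_apply (v : UnitAddTorus d → EuclideanSpace ℝ d) (y : UnitAddTorus d) (i j : d) :
    tracelessSq v y j i = v y i * v y j - if i = j then ‖v y‖ ^ 2 / Fintype.card d else 0 := by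
  simp [tracelessSq, mul_comm, PiLp.single_apply]

/-- `v ⊗̊ v` is symmetric. [folklore] -/
theorem tracelessSq_symm (v : UnitAddTorus d → EuclideanSpace ℝ d) (y : UnitAddTorus d) (i j : d) :
    tracelessSq v y i j = tracelessSq v y j i := by
  rw [tracelessSq_apply, tracelessSq_apply, mul_comm]
  by_cases h : i = j
  · subst h; rfl
  · rw [if_neg h, if_neg (Ne.symm h)]

/-- `v ⊗̊ v` is trace free (in dimension `card d ≥ 1`). [folklore] -/
theorem tracelessSq_traceFree (hd : 0 < Fintype.card d) (v : UnitAddTorus d → EuclideanSpace ℝ d)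
    (y : UnitAddTorus d) : ∑ i, tracelessSq v y i i = 0 := by
  simp only [tracelessSq_apply, if_true, Finset.sum_sub_distrib, Finset.sum_const, Finset.card_univ,
    nsmul_eq_mul]
  have hd' : (Fintype.card d : ℝ) ≠ 0 := by exact_mod_cast hd.ne'
  rw [mul_div_cancel₀ _ hd', EuclideanSpace.real_norm_sq_eq]
  simp [pow_two]

/-- Pointwise bound `‖(v ⊗̊ v)(y)‖ ≤ 2 ‖v(y)‖²` (column-sup norm). [folklore] -/
theorem norm_tracelessSq_le (v : UnitAddTorus d → EuclideanSpace ℝ d) (y : UnitAddTorus d) :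
    ‖tracelessSq v y‖ ≤ 2 * ‖v y‖ ^ 2 := by
  refine (pi_norm_le_iff_of_nonneg (by positivity)).2 fun j => ?_
  simp only [tracelessSq]
  have h1 : ‖v y j • v y‖ ≤ ‖v y‖ ^ 2 := by
    rw [norm_smul, pow_two]
    exact mul_le_mul_of_nonneg_right (PiLp.norm_apply_le (v y) j) (norm_nonneg _)
  have h2 : ‖(‖v y‖ ^ 2 / Fintype.card d) • EuclideanSpace.single j (1 : ℝ)‖ ≤ ‖v y‖ ^ 2 := by
    rw [norm_smul, PiLp.norm_single, norm_one, mul_one, Real.norm_of_nonneg (by positivity)]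
    exact div_le_self (by positivity) (by exact_mod_cast Fintype.card_pos_iff.2 ⟨j⟩)
  calc ‖v y j • v y - (‖v y‖ ^ 2 / Fintype.card d) • EuclideanSpace.single j (1 : ℝ)‖
      ≤ ‖v y j • v y‖ + ‖(‖v y‖ ^ 2 / Fintype.card d) • EuclideanSpace.single j (1 : ℝ)‖ := norm_sub_le _ _
    _ ≤ ‖v y‖ ^ 2 + ‖v y‖ ^ 2 := add_le_add h1 h2
    _ = 2 * ‖v y‖ ^ 2 := by ring

omit [DecidableEq d] in
/-- Tensor products of smooth fields are smooth. [folklore] -/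
theorem _root_.Literature.Analysis.FunctionSpaces.Torus.IsSmooth.tensorProd {v w : UnitAddTorus d → EuclideanSpace ℝ d}
    (hv : IsSmooth v) (hw : IsSmooth w) : IsSmooth (tensorProd v w) :=
  contDiff_pi.2 fun j => ContDiff.smul (hw.apply j) hv

/-- `v ⊗̊ v` is smooth for smooth `v`. [folklore] -/
theorem _root_.Literature.Analysis.FunctionSpaces.Torus.IsSmooth.tracelessSq {v : UnitAddTorus d → EuclideanSpace ℝ d}
    (hv : IsSmooth v) : IsSmooth (tracelessSq v) :=
  contDiff_pi.2 fun j => (ContDiff.smul (hv.apply j) hv).sub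
    ((hv.norm_sq.div_const _).smul contDiff_const)

/-- The tensor divergence is additive (`C¹` tensor fields). [folklore] -/
theorem tensorDivergence_add_apply {S₁ S₂ : UnitAddTorus d → d → EuclideanSpace ℝ d}
    (h₁ : IsContDiff 1 S₁) (h₂ : IsContDiff 1 S₂) (x : UnitAddTorus d) :
    tensorDivergence (fun y j => S₁ y j + S₂ y j) x = tensorDivergence S₁ x + tensorDivergence S₂ x := by
  unfold tensorDivergence
  rw [← Finset.sum_add_distrib]
  refine Finset.sum_congr rfl fun j _ => ?_
  have h1j : IsContDiff 1 (fun y => S₁ y j) :=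
    (ContinuousLinearMap.proj (R := ℝ) (φ := fun _ : d => EuclideanSpace ℝ d) j).contDiff.comp h₁
  have h2j : IsContDiff 1 (fun y => S₂ y j) :=
    (ContinuousLinearMap.proj (R := ℝ) (φ := fun _ : d => EuclideanSpace ℝ d) j).contDiff.comp h₂
  rw [show (fun y => S₁ y j + S₂ y j) = (fun y => S₁ y j) + fun y => S₂ y j from rfl,
    FunctionSpaces.Torus.partialDeriv_add h1j h2j]
  rfl

/-- The tensor divergence is homogeneous (`C¹` tensor fields). [folklore] -/
theorem tensorDivergence_const_smul_apply {S : UnitAddTorus d → d → EuclideanSpace ℝ d}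
    (hS : IsContDiff 1 S) (c : ℝ) (x : UnitAddTorus d) :
    tensorDivergence (fun y j => c • S y j) x = c • tensorDivergence S x := by
  rw [show (fun y j => c • S y j) = c • S from rfl]
  exact tensorDivergence_const_smul hS c x

/-- **`div (v ⊗ w) = (w·∇)v + (div w) v`** for smooth fields (column `j` of `v ⊗ w` is `wⱼ v`,
and `∂ⱼ(wⱼ v) = wⱼ ∂ⱼv + (∂ⱼwⱼ) v`). [folklore] -/
theorem tensorDivergence_tensorProd {v w : UnitAddTorus d → EuclideanSpace ℝ d} (hv : IsSmooth v)
    (hw : IsSmooth w) (x : UnitAddTorus d) :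
    tensorDivergence (tensorProd v w) x = FunctionSpaces.Torus.convect w v x + FunctionSpaces.Torus.divergence w x • v x := by
  unfold tensorDivergence tensorProd
  have h1 : ∀ j, FunctionSpaces.Torus.partialDeriv j (fun y => w y j • v y) x =
      w x j • FunctionSpaces.Torus.partialDeriv j v x + FunctionSpaces.Torus.partialDeriv j (fun y => w y j) x • v x := fun j =>
    partialDeriv_smul ((hw.apply j).isContDiff (by simp)) (hv.isContDiff (by simp)) j x
  simp_rw [h1]
  rw [Finset.sum_add_distrib, FunctionSpaces.Torus.convect,
    fderiv_apply_eq_sum_partialDeriv (hv.isContDiff (by simp)), FunctionSpaces.Torus.divergence, Finset.sum_smul]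

/-- `div (f Id) = ∇f` for a `C¹` scalar `f` (column `j` of `f Id` is `f eⱼ`). [folklore] -/
theorem tensorDivergence_smul_single {f : UnitAddTorus d → ℝ} (hf : IsContDiff 1 f)
    (x : UnitAddTorus d) :
    tensorDivergence (fun y j => f y • EuclideanSpace.single j (1 : ℝ)) x = FunctionSpaces.Torus.gradient f x := by
  unfold tensorDivergence
  rw [gradient_eq_sum_partialDeriv hf]
  refine Finset.sum_congr rfl fun j _ => ?_
  rw [partialDeriv_smul hf (isContDiff_const _) j x]
  simp [FunctionSpaces.Torus.partialDeriv, FunctionSpaces.Torus.lineDeriv]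

/-- **`div (v ⊗̊ v) = (v·∇)v - ∇(|v|²/d)`** for a smooth divergence-free field. [folklore] -/
theorem tensorDivergence_tracelessSq {v : UnitAddTorus d → EuclideanSpace ℝ d} (hv : IsSmooth v)
    (hdiv : FunctionSpaces.Torus.IsDivFree v) (x : UnitAddTorus d) :
    tensorDivergence (tracelessSq v) x =
      FunctionSpaces.Torus.convect v v x - FunctionSpaces.Torus.gradient (fun y => ‖v y‖ ^ 2 / Fintype.card d) x := by
  have hsq : IsContDiff 1 (fun y => ‖v y‖ ^ 2 / Fintype.card d) :=
    (hv.norm_sq.div_const _).of_le (by simp)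
  have hsq' : IsContDiff 1 (fun y => (-1) * (‖v y‖ ^ 2 / Fintype.card d)) := by
    change ContDiff ℝ 1 (fun z => (-1) * (‖v (proj z)‖ ^ 2 / Fintype.card d))
    exact contDiff_const.mul hsq
  have hT : IsContDiff 1 (tensorProd v v) := (hv.tensorProd hv).isContDiff (by simp)
  have hN : IsContDiff 1 (fun y (j : d) =>
      ((-1) * (‖v y‖ ^ 2 / Fintype.card d)) • (EuclideanSpace.single j (1 : ℝ) : EuclideanSpace ℝ d)) :=
    contDiff_pi.2 fun j => by
      change ContDiff ℝ 1 (fun z => ((-1) * (‖v (proj z)‖ ^ 2 / Fintype.card d)) •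
        (EuclideanSpace.single j (1 : ℝ) : EuclideanSpace ℝ d))
      exact ContDiff.smul hsq' contDiff_const
  have h : tracelessSq v = fun y j => tensorProd v v y j +
      ((-1) * (‖v y‖ ^ 2 / Fintype.card d)) • EuclideanSpace.single j (1 : ℝ) := by
    funext y j
    simp [tracelessSq, tensorProd, sub_eq_add_neg]
  rw [h, tensorDivergence_add_apply hT hN, tensorDivergence_tensorProd hv hv,
    tensorDivergence_smul_single hsq', gradient_const_mul_apply hsq, hdiv x]
  simp [sub_eq_add_neg]

end Tensor

end TensorCalculus

section TimeCutoff

open FunctionSpaces.Torus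

variable {d : Type*} [Fintype d]
variable {F : Type*} [NormedAddCommGroup F] [NormedSpace ℝ F]

/-! ## Gluing a slab-smooth field into a longer time set with a temporal cut-off -/

section Cutoff

variable {S : Set ℝ} {a b : ℝ} {χ : ℝ → ℝ} {w : ℝ → UnitAddTorus d → F}

/-- **Admissible temporal cut-offs for a field living on `[a, b]`**, relative to a time set `S`:
`χ` is smooth, and at each end of `[a, b]` either `S` does not extend beyond that end or `χ`
vanishes identically on a neighbourhood of everything beyond a point strictly inside (CL22,
§3.2: the cut-offs `χᵢ` vanish for `t ≤ tᵢ + τ/2` and for `t ≥ tᵢ₊₁ - τ/2`, except that "we do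
not cut near the endpoints `t = 0` and `t = 1`"). [cite: CheskidovLuo2022, §3.2 (3.3)–(3.5)] -/
structure IsTimeCutoff (S : Set ℝ) (a b : ℝ) (χ : ℝ → ℝ) : Prop where
  /-- The cut-off is smooth. -/
  contDiff : ContDiff ℝ ∞ χ
  /-- Left end: `S ⊆ [a, ∞)` or `χ = 0` on `(-∞, a']` for some `a' > a`. -/
  left : S ⊆ Ici a ∨ ∃ a', a < a' ∧ ∀ t ≤ a', χ t = 0
  /-- Right end: `S ⊆ (-∞, b]` or `χ = 0` on `[b', ∞)` for some `b' < b`. -/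
  right : S ⊆ Iic b ∨ ∃ b', b' < b ∧ ∀ t ≥ b', χ t = 0

/-- The local trichotomy behind the gluing: at a time `t ∈ S`, either `χ` vanishes on an open
neighbourhood of `t`, or `S` agrees with a subset of `[a, b]` near `t`. [folklore] -/
theorem IsTimeCutoff.local_cases (h : IsTimeCutoff S a b χ) (t : ℝ) :
    (∃ V : Set ℝ, IsOpen V ∧ t ∈ V ∧ ∀ s ∈ V, χ s = 0) ∨
      ∃ V : Set ℝ, IsOpen V ∧ t ∈ V ∧ S ∩ V ⊆ Icc a b := by
  -- left constraint
  have hL : (∃ V : Set ℝ, IsOpen V ∧ t ∈ V ∧ ∀ s ∈ V, χ s = 0) ∨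
      ∃ V₁ : Set ℝ, IsOpen V₁ ∧ t ∈ V₁ ∧ ∀ s ∈ S ∩ V₁, a ≤ s := by
    rcases h.left with hS | ⟨a', haa', ha'⟩
    · exact Or.inr ⟨univ, isOpen_univ, mem_univ _, fun s hs => hS hs.1⟩
    · rcases lt_or_ge t a' with hta | hta
      · exact Or.inl ⟨Iio a', isOpen_Iio, hta, fun s hs => ha' s (le_of_lt hs)⟩
      · exact Or.inr ⟨Ioi a, isOpen_Ioi, lt_of_lt_of_le haa' hta, fun s hs => le_of_lt hs.2⟩
  have hR : (∃ V : Set ℝ, IsOpen V ∧ t ∈ V ∧ ∀ s ∈ V, χ s = 0) ∨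
      ∃ V₂ : Set ℝ, IsOpen V₂ ∧ t ∈ V₂ ∧ ∀ s ∈ S ∩ V₂, s ≤ b := by
    rcases h.right with hS | ⟨b', hbb', hb'⟩
    · exact Or.inr ⟨univ, isOpen_univ, mem_univ _, fun s hs => hS hs.1⟩
    · rcases lt_or_ge b' t with htb | htb
      · exact Or.inl ⟨Ioi b', isOpen_Ioi, htb, fun s hs => hb' s (le_of_lt hs)⟩
      · exact Or.inr ⟨Iio b, isOpen_Iio, lt_of_le_of_lt htb hbb', fun s hs => le_of_lt hs.2⟩
  rcases hL with hL | ⟨V₁, hV₁o, htV₁, hV₁⟩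
  · exact Or.inl hL
  rcases hR with hR | ⟨V₂, hV₂o, htV₂, hV₂⟩
  · exact Or.inl hR
  exact Or.inr ⟨V₁ ∩ V₂, hV₁o.inter hV₂o, ⟨htV₁, htV₂⟩, fun s hs =>
    ⟨hV₁ s ⟨hs.1, hs.2.1⟩, hV₂ s ⟨hs.1, hs.2.2⟩⟩⟩

/-- **Gluing by a temporal cut-off preserves joint smoothness**: if `w` is jointly smooth on
`[a, b] × 𝕋^d` and `χ` is an admissible cut-off for `[a, b]` relative to `S`, then
`(t, x) ↦ χ(t) w(t, x)` is jointly smooth on `S × 𝕋^d` (whatever `w` is off `[a, b]`)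
(CL22, §3.2: the glued velocity `u + ∑ᵢ χᵢvᵢ` is smooth). [cite: CheskidovLuo2022, §3.2] -/
theorem IsTimeCutoff.isSmoothSpaceTimeOn_smul (h : IsTimeCutoff S a b χ)
    (hw : FunctionSpaces.Torus.IsSmoothSpaceTimeOn (Icc a b) w) : FunctionSpaces.Torus.IsSmoothSpaceTimeOn S (fun t x => χ t • w t x) := by
  refine contDiffOn_of_locally_contDiffOn fun p hp => ?_
  obtain ⟨t, y⟩ := p
  have ht : t ∈ S := (mem_prod.1 hp).1
  rcases h.local_cases t with ⟨V, hVo, htV, hV⟩ | ⟨V, hVo, htV, hV⟩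
  · refine ⟨V ×ˢ univ, hVo.prod isOpen_univ, ⟨htV, mem_univ _⟩, ?_⟩
    refine (contDiffOn_const (c := (0 : F))).congr fun q hq => ?_
    have hq1 : q.1 ∈ V := (mem_prod.1 hq.2).1
    simp [stLift, hV q.1 hq1]
  · refine ⟨V ×ˢ univ, hVo.prod isOpen_univ, ⟨htV, mem_univ _⟩, ?_⟩
    have hsub : S ×ˢ (univ : Set (EuclideanSpace ℝ d)) ∩ V ×ˢ univ ⊆ Icc a b ×ˢ univ := by
      intro q hq
      exact ⟨hV ⟨(mem_prod.1 hq.1).1, (mem_prod.1 hq.2).1⟩, mem_univ _⟩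
    have hχ' : ContDiffOn ℝ ∞ (fun q : ℝ × EuclideanSpace ℝ d => χ q.1)
        (S ×ˢ (univ : Set (EuclideanSpace ℝ d)) ∩ V ×ˢ univ) :=
      (h.contDiff.comp contDiff_fst).contDiffOn
    exact hχ'.smul (ContDiffOn.mono hw hsub)

/-- **Time derivative of a glued field**: for an admissible cut-off, at every `t ∈ S` the slice
`s ↦ χ(s) w(s, x)` has the one-sided derivative `χ'(t) w(t, x) + χ(t) ∂ₜw(t, x)` within `S`,
where `∂ₜw` is the one-sided derivative within `[a, b]` (both junk terms are killed by
`χ(t) = χ'(t) = 0` when `t` is off `[a, b]`). [folklore] -/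
theorem IsTimeCutoff.hasDerivWithinAt_smul (h : IsTimeCutoff S a b χ)
    (hw : FunctionSpaces.Torus.IsSmoothSpaceTimeOn (Icc a b) w) {t : ℝ} (ht : t ∈ S) (x : UnitAddTorus d) :
    HasDerivWithinAt (fun s => χ s • w s x)
      (deriv χ t • w t x + χ t • FunctionSpaces.Torus.timeDerivWithin (Icc a b) w t x) S t := by
  rcases h.local_cases t with ⟨V, hVo, htV, hV⟩ | ⟨V, hVo, htV, hV⟩
  · -- `χ` vanishes near `t`: the slice is locally zero and both terms vanish
    have hVn : V ∈ 𝓝 t := hVo.mem_nhds htV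
    have hev : (fun s => χ s • w s x) =ᶠ[𝓝 t] fun _ => (0 : F) := by
      filter_upwards [hVn] with s hs
      simp [hV s hs]
    have hχev : χ =ᶠ[𝓝 t] fun _ => (0 : ℝ) := by
      filter_upwards [hVn] with s hs
      exact hV s hs
    have hd0 : deriv χ t = 0 := by
      rw [hχev.deriv_eq]; simp
    have hzero : HasDerivAt (fun s => χ s • w s x) 0 t :=
      (hasDerivAt_const t (0 : F)).congr_of_eventuallyEq hev
    rw [hd0, hV t htV, zero_smul, zero_smul, add_zero]
    exact hzero.hasDerivWithinAt
  · -- near `t`, `S` lies in `[a, b]`: product rule with the one-sided derivative of `w`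
    have htab : t ∈ Icc a b := hV ⟨ht, htV⟩
    have hmem : Icc a b ∈ 𝓝[S] t := by
      have : S ∩ V ∈ 𝓝[S] t := inter_mem_nhdsWithin S (hVo.mem_nhds htV)
      exact mem_of_superset this hV
    have h1 : HasDerivWithinAt (fun s => w s x) (FunctionSpaces.Torus.timeDerivWithin (Icc a b) w t x) S t :=
      (hw.hasDerivWithinAt_slice htab x).mono_of_mem_nhdsWithin hmem
    have h2 : HasDerivWithinAt χ (deriv χ t) S t :=
      ((h.contDiff.differentiable (by simp)) t).hasDerivAt.hasDerivWithinAt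
    have h12 := h2.smul h1
    rw [add_comm]
    exact h12

/-- For an admissible cut-off, `χ(t) ≠ 0` at a time of `S` forces `t ∈ [a, b]`. [folklore] -/
theorem IsTimeCutoff.mem_Icc_of_ne_zero (h : IsTimeCutoff S a b χ) {t : ℝ} (ht : t ∈ S)
    (hχt : χ t ≠ 0) : t ∈ Icc a b := by
  rcases h.local_cases t with ⟨V, _, htV, hV⟩ | ⟨V, _, htV, hV⟩
  · exact absurd (hV t htV) hχt
  · exact hV ⟨ht, htV⟩

/-- For an admissible cut-off, `χ'(t) ≠ 0` at a time of `S` forces `t ∈ [a, b]`. [folklore] -/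
theorem IsTimeCutoff.mem_Icc_of_deriv_ne_zero (h : IsTimeCutoff S a b χ) {t : ℝ} (ht : t ∈ S)
    (hχt : deriv χ t ≠ 0) : t ∈ Icc a b := by
  rcases h.local_cases t with ⟨V, hVo, htV, hV⟩ | ⟨V, _, htV, hV⟩
  · have hχev : χ =ᶠ[𝓝 t] fun _ => (0 : ℝ) := by
      filter_upwards [hVo.mem_nhds htV] with s hs
      exact hV s hs
    rw [hχev.deriv_eq, deriv_const] at hχt
    exact absurd rfl hχt
  · exact hV ⟨ht, htV⟩

end Cutoff

/-! ## Smoothness in time of space integrals -/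

section Integral

variable {S : Set ℝ} {w : ℝ → UnitAddTorus d → F}

/-- **Space integrals of jointly smooth fields are smooth in time** (on convex time sets of
unique differentiability): `t ↦ ∫ w(t, x) dx` is `C^∞` on `S`, its derivative within `S` being
`∫ ∂ₜw` with `∂ₜw` again jointly smooth (induction on the order). [folklore] -/
theorem _root_.Literature.Analysis.FunctionSpaces.Torus.IsSmoothSpaceTimeOn.contDiffOn_integral
    (hw : FunctionSpaces.Torus.IsSmoothSpaceTimeOn S w) (hU : UniqueDiffOn ℝ S) (hc : Convex ℝ S) :
    ContDiffOn ℝ ∞ (fun t => ∫ x, w t x) S := by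
  suffices H : ∀ n : ℕ, ∀ v : ℝ → UnitAddTorus d → F, FunctionSpaces.Torus.IsSmoothSpaceTimeOn S v →
      ContDiffOn ℝ n (fun t => ∫ x, v t x) S from
    contDiffOn_infty.2 fun n => H n w hw
  intro n
  induction n with
  | zero =>
    intro v hv
    exact contDiffOn_zero.2 (hv.continuousOn_integral hc)
  | succ n ih =>
    intro v hv
    have hderiv : ∀ t ∈ S, HasDerivWithinAt (fun s => ∫ x, v s x)
        (∫ x, FunctionSpaces.Torus.timeDerivWithin S v t x) S t := fun t ht => hv.hasDerivWithinAt_integral hc ht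
    rw [Nat.cast_succ]
    refine (contDiffOn_succ_iff_derivWithin hU).2 ⟨fun t ht => (hderiv t ht).differentiableWithinAt,
      fun h => absurd h WithTop.coe_ne_top, ?_⟩
    have heq : EqOn (derivWithin (fun s => ∫ x, v s x) S) (fun t => ∫ x, FunctionSpaces.Torus.timeDerivWithin S v t x) S :=
      fun t ht => (hderiv t ht).derivWithin (hU t ht)
    exact (ih _ (hv.timeDerivWithin hU)).congr heq

/-- The space mean of a jointly smooth field, viewed as a (spatially constant) space–time field,
is jointly smooth. [folklore] -/
theorem _root_.Literature.Analysis.FunctionSpaces.Torus.IsSmoothSpaceTimeOn.integral_const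
    (hw : FunctionSpaces.Torus.IsSmoothSpaceTimeOn S w) (hU : UniqueDiffOn ℝ S) (hc : Convex ℝ S) :
    FunctionSpaces.Torus.IsSmoothSpaceTimeOn S (fun t (_ : UnitAddTorus d) => ∫ x, w t x) := by
  have h := hw.contDiffOn_integral hU hc
  change ContDiffOn ℝ ∞ (fun p : ℝ × EuclideanSpace ℝ d => ∫ x, w p.1 x) (S ×ˢ univ)
  exact h.comp contDiff_fst.contDiffOn fun p hp => (mem_prod.1 hp).1

end Integral

end TimeCutoff

section Grid

/-! ## A derivative bound for Mathlib's smooth transition -/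

section SmoothTransition

/-- Chain rule for the smooth transition along an affine reparametrisation. [folklore] -/
theorem hasDerivAt_smoothTransition_affine (α β t : ℝ) :
    HasDerivAt (fun s => Real.smoothTransition (α * s + β))
      (α * deriv Real.smoothTransition (α * t + β)) t := by
  have h1 : HasDerivAt Real.smoothTransition (deriv Real.smoothTransition (α * t + β)) (α * t + β) :=
    (Calculus.differentiable_smoothTransition _).hasDerivAt
  have h2 : HasDerivAt (fun s => α * s + β) α t := by
    simpa using ((hasDerivAt_id t).const_mul α).add_const β
  have := h1.comp t h2
  rw [mul_comm] at this
  exact this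

end SmoothTransition

namespace Concentration

/-- A universal bound `M_S ≥ 1` for `|S'|`, `S = Real.smoothTransition`, fixed once and for all
from `Literature.Analysis.Calculus.exists_bound_deriv_smoothTransition` (the `max` with `1` only
normalises `M_S ≥ 1`); it enters the constant `C(r, ε) = 4 M_S C_r + 2` of Prop. 3.1. [folklore] -/
def cutoffDerivBound : ℝ := max 1 (Classical.choose Calculus.exists_bound_deriv_smoothTransition)

/-- `M_S ≥ 1`. [folklore] -/
theorem one_le_cutoffDerivBound : 1 ≤ cutoffDerivBound := le_max_left _ _

/-- `|S'| ≤ M_S` everywhere. [folklore] -/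
theorem abs_deriv_smoothTransition_le_cutoffDerivBound (x : ℝ) :
    |deriv Real.smoothTransition x| ≤ cutoffDerivBound :=
  ((Classical.choose_spec Calculus.exists_bound_deriv_smoothTransition).2 x).trans (le_max_right _ _)

end Concentration

/-! ## The cut-off family of the sharp gluing (CL22, §3.2) -/

namespace Concentration

variable {T τ : ℝ} {n : ℕ}

/-- The nodes `tᵢ = i T / n` of the uniform subdivision of `[0, T]` into `n` intervals (CL22,
§3.1: "`tᵢ = iτ^ε`", "we assume `τ^{-ε}` is always an integer so that the time interval `[0,1]`
is perfectly divided"). [cite: CheskidovLuo2022, §3.1] -/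
def node (T : ℝ) (n : ℕ) (i : ℕ) : ℝ := i * (T / n)

/-- `t₀ = 0`. [folklore] -/
theorem node_zero (T : ℝ) (n : ℕ) : node T n 0 = 0 := by simp [node]

/-- `tₙ = T`. [folklore] -/
theorem node_self (T : ℝ) {n : ℕ} (hn : n ≠ 0) : node T n n = T := by
  have : (n : ℝ) ≠ 0 := by exact_mod_cast hn
  unfold node
  field_simp

/-- `tᵢ₊₁ = tᵢ + T/n`. [folklore] -/
theorem node_succ (T : ℝ) (n : ℕ) (i : ℕ) : node T n (i + 1) = node T n i + T / n := by
  simp [node]; ring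

/-- `tᵢ - tⱼ = (i - j) T/n`. [folklore] -/
theorem node_sub_node (T : ℝ) (n : ℕ) (i j : ℕ) :
    node T n i - node T n j = ((i : ℝ) - j) * (T / n) := by
  simp [node]; ring

/-- The nodes increase with the index. [folklore] -/
theorem node_mono (hT : 0 ≤ T) (n : ℕ) {i j : ℕ} (hij : i ≤ j) : node T n i ≤ node T n j := by
  unfold node
  exact mul_le_mul_of_nonneg_right (by exact_mod_cast hij) (by positivity)

/-- The nodes increase strictly with the index (`T > 0`, `n ≥ 1`). [folklore] -/
theorem node_lt_node (hT : 0 < T) (hn : 0 < n) {i j : ℕ} (hij : i < j) : node T n i < node T n j := by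
  unfold node
  have : (0 : ℝ) < T / n := div_pos hT (by exact_mod_cast hn)
  exact mul_lt_mul_of_pos_right (by exact_mod_cast hij) this

/-- Successive nodes are one step apart: `t_{i+1} - tᵢ = T/n`; nodes `j ≤ i` satisfy
`tⱼ + T/n ≤ t_{i+1}`. [folklore] -/
theorem node_add_step_le (hT : 0 ≤ T) (n : ℕ) {i j : ℕ} (hji : j ≤ i) :
    node T n j + T / n ≤ node T n (i + 1) := by
  rw [← node_succ]
  exact node_mono hT n (Nat.succ_le_succ hji)

/-- **The cut-off `χᵢ` of the sharp gluing** at scale `τ` on the grid `tᵢ = iT/n` (CL22, §3.2,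
(3.3)–(3.5)), built from Mathlib's smooth transition `S` with transition length `τ/4`:
`χᵢ(t) = S((t - tᵢ - τ/2)/(τ/4)) · S((tᵢ₊₁ - τ/2 - t)/(τ/4))`, the first factor omitted for
`i = 0` and the second for `i = n - 1` ("we do not cut near the endpoints `t = 0` and `t = 1`").
Thus `χᵢ = 0` for `t ≤ tᵢ + τ/2` (`i ≠ 0`) and for `t ≥ tᵢ₊₁ - τ/2` (`i ≠ n - 1`), `χᵢ = 1` on
`[tᵢ + 3τ/4, tᵢ₊₁ - 3τ/4]` — in particular on the printed plateau `[tᵢ + τ, tᵢ₊₁ - τ]` — and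
`|χᵢ'| ≲ τ⁻¹` ("`|∇^m χᵢ| ≲_m τ^{-m}`", `m = 1`). The faster transition (`τ/4` instead of the
printed `τ/2`) only changes the implicit constant. [cite: CheskidovLuo2022, §3.2 (3.3)–(3.5)] -/
def cutoff (T : ℝ) (n : ℕ) (τ : ℝ) (i : ℕ) (t : ℝ) : ℝ :=
  (if i = 0 then 1 else Real.smoothTransition ((t - node T n i - τ / 2) / (τ / 4))) *
    (if i + 1 = n then 1 else Real.smoothTransition ((node T n (i + 1) - τ / 2 - t) / (τ / 4)))

/-- The rising factor of `χᵢ` in affine form. [folklore] -/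
theorem cutoff_left_factor_eq (T : ℝ) (n : ℕ) (τ : ℝ) (i : ℕ) (t : ℝ) :
    Real.smoothTransition ((t - node T n i - τ / 2) / (τ / 4)) =
      Real.smoothTransition ((4 / τ) * t + (-(node T n i + τ / 2) * (4 / τ))) := by
  congr 1; ring

/-- The falling factor of `χᵢ` in affine form. [folklore] -/
theorem cutoff_right_factor_eq (T : ℝ) (n : ℕ) (τ : ℝ) (i : ℕ) (t : ℝ) :
    Real.smoothTransition ((node T n (i + 1) - τ / 2 - t) / (τ / 4)) =
      Real.smoothTransition ((-(4 / τ)) * t + (node T n (i + 1) - τ / 2) * (4 / τ)) := by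
  congr 1; ring

/-- The cut-offs are smooth. [folklore] -/
theorem contDiff_cutoff (T : ℝ) (n : ℕ) (τ : ℝ) (i : ℕ) : ContDiff ℝ ∞ (cutoff T n τ i) := by
  unfold cutoff
  refine ContDiff.mul ?_ ?_
  · split_ifs
    · exact contDiff_const
    · exact Real.smoothTransition.contDiff.comp ((contDiff_id.sub contDiff_const).sub contDiff_const
        |>.div_const _)
  · split_ifs
    · exact contDiff_const
    · exact Real.smoothTransition.contDiff.comp ((contDiff_const.sub contDiff_const).sub contDiff_id
        |>.div_const _)

/-- `0 ≤ χᵢ`. [folklore] -/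
theorem cutoff_nonneg (T : ℝ) (n : ℕ) (τ : ℝ) (i : ℕ) (t : ℝ) : 0 ≤ cutoff T n τ i t := by
  unfold cutoff
  refine mul_nonneg ?_ ?_
  · split_ifs
    exacts [zero_le_one, Real.smoothTransition.nonneg _]
  · split_ifs
    exacts [zero_le_one, Real.smoothTransition.nonneg _]

/-- `χᵢ ≤ 1`. [folklore] -/
theorem cutoff_le_one (T : ℝ) (n : ℕ) (τ : ℝ) (i : ℕ) (t : ℝ) : cutoff T n τ i t ≤ 1 := by
  unfold cutoff
  refine mul_le_one₀ ?_ ?_ ?_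
  · split_ifs
    exacts [le_rfl, Real.smoothTransition.le_one _]
  · split_ifs
    exacts [zero_le_one, Real.smoothTransition.nonneg _]
  · split_ifs
    exacts [le_rfl, Real.smoothTransition.le_one _]

/-- `|χᵢ| ≤ 1`. [folklore] -/
theorem abs_cutoff_le_one (T : ℝ) (n : ℕ) (τ : ℝ) (i : ℕ) (t : ℝ) : |cutoff T n τ i t| ≤ 1 := by
  rw [abs_of_nonneg (cutoff_nonneg T n τ i t)]
  exact cutoff_le_one T n τ i t

/-- `χᵢ(t) = 0` for `t ≤ tᵢ + τ/2` when `i ≠ 0` (CL22, (3.3)). [cite: CheskidovLuo2022, §3.2 (3.3)] -/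
theorem cutoff_eq_zero_of_le (hτ : 0 < τ) {i : ℕ} (hi : i ≠ 0) {t : ℝ}
    (ht : t ≤ node T n i + τ / 2) : cutoff T n τ i t = 0 := by
  unfold cutoff
  rw [if_neg hi]
  apply mul_eq_zero_of_left
  apply Real.smoothTransition.zero_of_nonpos
  exact div_nonpos_of_nonpos_of_nonneg (by linarith) (by positivity)

/-- `χᵢ(t) = 0` for `t ≥ tᵢ₊₁ - τ/2` when `i ≠ n - 1` (CL22, (3.3)). [cite: CheskidovLuo2022, §3.2 (3.3)] -/
theorem cutoff_eq_zero_of_ge (hτ : 0 < τ) {i : ℕ} (hi : i + 1 ≠ n) {t : ℝ}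
    (ht : node T n (i + 1) - τ / 2 ≤ t) : cutoff T n τ i t = 0 := by
  unfold cutoff
  rw [if_neg hi]
  apply mul_eq_zero_of_right
  apply Real.smoothTransition.zero_of_nonpos
  exact div_nonpos_of_nonpos_of_nonneg (by linarith) (by positivity)

/-- `χᵢ(t) = 1` on the plateau `[tᵢ + 3τ/4, tᵢ₊₁ - 3τ/4]` (the constraint at an end being void
for `i = 0`, resp. `i = n - 1`) (CL22, (3.3)–(3.5)). [cite: CheskidovLuo2022, §3.2 (3.3)–(3.5)] -/
theorem cutoff_eq_one (hτ : 0 < τ) {i : ℕ} {t : ℝ} (hl : i = 0 ∨ node T n i + 3 * τ / 4 ≤ t)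
    (hr : i + 1 = n ∨ t ≤ node T n (i + 1) - 3 * τ / 4) : cutoff T n τ i t = 1 := by
  unfold cutoff
  have h1 : (if i = 0 then 1 else Real.smoothTransition ((t - node T n i - τ / 2) / (τ / 4))) = 1 := by
    split_ifs with h
    · rfl
    · rcases hl with hl | hl
      · exact absurd hl h
      · apply Real.smoothTransition.one_of_one_le
        rw [le_div_iff₀ (by positivity)]; linarith
  have h2 : (if i + 1 = n then 1 else
      Real.smoothTransition ((node T n (i + 1) - τ / 2 - t) / (τ / 4))) = 1 := by
    split_ifs with h
    · rfl
    · rcases hr with hr | hr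
      · exact absurd hr h
      · apply Real.smoothTransition.one_of_one_le
        rw [le_div_iff₀ (by positivity)]; linarith
  rw [h1, h2, mul_one]

/-- **Derivative bound `|χᵢ'| ≤ 8 M_S / τ`** (CL22, §3.2: "`|∇^m χᵢ| ≲_m τ^{-m}` uniformly in
`τ` and `i`"). [cite: CheskidovLuo2022, §3.2] -/
theorem abs_deriv_cutoff_le (hτ : 0 < τ) (i : ℕ) (t : ℝ) :
    |deriv (cutoff T n τ i) t| ≤ 8 * cutoffDerivBound / τ := by
  -- the two factors and their derivatives
  set f : ℝ → ℝ := fun s => if i = 0 then 1 else Real.smoothTransition ((s - node T n i - τ / 2) / (τ / 4))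
    with hf
  set g : ℝ → ℝ := fun s => if i + 1 = n then 1 else
    Real.smoothTransition ((node T n (i + 1) - τ / 2 - s) / (τ / 4)) with hg
  have hfg : cutoff T n τ i = fun s => f s * g s := by funext s; rfl
  have hM := one_le_cutoffDerivBound
  have h4 : 0 ≤ 4 * cutoffDerivBound / τ := div_nonneg (by linarith) hτ.le
  -- derivative of `f` with bound `4 M / τ`
  obtain ⟨f', hf', hf'b⟩ : ∃ f' : ℝ, HasDerivAt f f' t ∧ |f'| ≤ 4 * cutoffDerivBound / τ := by
    by_cases h : i = 0
    · refine ⟨0, ?_, ?_⟩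
      · simp only [hf, h, if_true]; exact hasDerivAt_const _ _
      · rw [abs_zero]; exact h4
    · refine ⟨(4 / τ) * deriv Real.smoothTransition ((4 / τ) * t + (-(node T n i + τ / 2) * (4 / τ))), ?_, ?_⟩
      · simp only [hf, h, if_false]
        have := hasDerivAt_smoothTransition_affine (4 / τ) (-(node T n i + τ / 2) * (4 / τ)) t
        refine this.congr_of_eventuallyEq (Eventually.of_forall fun s => ?_)
        exact cutoff_left_factor_eq T n τ i s
      · rw [abs_mul, abs_of_pos (by positivity : (0 : ℝ) < 4 / τ)]
        calc 4 / τ * |deriv Real.smoothTransition ((4 / τ) * t + (-(node T n i + τ / 2) * (4 / τ)))|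
            ≤ 4 / τ * cutoffDerivBound := by
              gcongr; exact abs_deriv_smoothTransition_le_cutoffDerivBound _
          _ = 4 * cutoffDerivBound / τ := by ring
  obtain ⟨g', hg', hg'b⟩ : ∃ g' : ℝ, HasDerivAt g g' t ∧ |g'| ≤ 4 * cutoffDerivBound / τ := by
    by_cases h : i + 1 = n
    · refine ⟨0, ?_, ?_⟩
      · simp only [hg, h, if_true]; exact hasDerivAt_const _ _
      · rw [abs_zero]; exact h4
    · refine ⟨(-(4 / τ)) * deriv Real.smoothTransition ((-(4 / τ)) * t + (node T n (i + 1) - τ / 2) * (4 / τ)),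
        ?_, ?_⟩
      · simp only [hg, h, if_false]
        have := hasDerivAt_smoothTransition_affine (-(4 / τ)) ((node T n (i + 1) - τ / 2) * (4 / τ)) t
        refine this.congr_of_eventuallyEq (Eventually.of_forall fun s => ?_)
        exact cutoff_right_factor_eq T n τ i s
      · rw [abs_mul, abs_neg, abs_of_pos (by positivity : (0 : ℝ) < 4 / τ)]
        calc 4 / τ * |deriv Real.smoothTransition ((-(4 / τ)) * t + (node T n (i + 1) - τ / 2) * (4 / τ))|
            ≤ 4 / τ * cutoffDerivBound := by
              gcongr; exact abs_deriv_smoothTransition_le_cutoffDerivBound _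
          _ = 4 * cutoffDerivBound / τ := by ring
  have hfb : |f t| ≤ 1 := by
    simp only [hf]; split_ifs
    · simp
    · rw [abs_of_nonneg (Real.smoothTransition.nonneg _)]; exact Real.smoothTransition.le_one _
  have hgb : |g t| ≤ 1 := by
    simp only [hg]; split_ifs
    · simp
    · rw [abs_of_nonneg (Real.smoothTransition.nonneg _)]; exact Real.smoothTransition.le_one _
  have hprod : HasDerivAt (fun s => f s * g s) (f' * g t + f t * g') t := hf'.mul hg'
  rw [hfg, hprod.deriv]
  calc |f' * g t + f t * g'| ≤ |f' * g t| + |f t * g'| := abs_add_le _ _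
    _ = |f'| * |g t| + |f t| * |g'| := by rw [abs_mul, abs_mul]
    _ ≤ 4 * cutoffDerivBound / τ * 1 + 1 * (4 * cutoffDerivBound / τ) := by
        gcongr
    _ = 8 * cutoffDerivBound / τ := by ring

/-- **Support of `χᵢ'`**: off the two closed transition windows `[tᵢ + τ/2, tᵢ + 3τ/4]`
(`i ≠ 0`) and `[tᵢ₊₁ - 3τ/4, tᵢ₊₁ - τ/2]` (`i ≠ n - 1`) the cut-off is locally constant, so its
derivative vanishes. [folklore] -/
theorem deriv_cutoff_eq_zero (hτ : 0 < τ) {i : ℕ} {t : ℝ}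
    (hl : i = 0 ∨ t < node T n i + τ / 2 ∨ node T n i + 3 * τ / 4 < t)
    (hr : i + 1 = n ∨ t < node T n (i + 1) - 3 * τ / 4 ∨ node T n (i + 1) - τ / 2 < t) :
    deriv (cutoff T n τ i) t = 0 := by
  -- either `χᵢ` vanishes near `t`, or `χᵢ = 1` near `t`
  rcases hl with hl | hl | hl
  · -- `i = 0`: only the right factor matters
    rcases hr with hr | hr | hr
    · have hev : cutoff T n τ i =ᶠ[𝓝 t] fun _ => (1 : ℝ) := Eventually.of_forall fun s =>
        cutoff_eq_one hτ (Or.inl hl) (Or.inl hr)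
      rw [hev.deriv_eq, deriv_const]
    · have hev : cutoff T n τ i =ᶠ[𝓝 t] fun _ => (1 : ℝ) := by
        filter_upwards [Iio_mem_nhds hr] with s hs
        exact cutoff_eq_one hτ (Or.inl hl) (Or.inr (le_of_lt hs))
      rw [hev.deriv_eq, deriv_const]
    · by_cases hin : i + 1 = n
      · have hev : cutoff T n τ i =ᶠ[𝓝 t] fun _ => (1 : ℝ) := Eventually.of_forall fun s =>
          cutoff_eq_one hτ (Or.inl hl) (Or.inl hin)
        rw [hev.deriv_eq, deriv_const]
      · have hev : cutoff T n τ i =ᶠ[𝓝 t] fun _ => (0 : ℝ) := by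
          filter_upwards [Ioi_mem_nhds hr] with s hs
          exact cutoff_eq_zero_of_ge hτ hin (le_of_lt hs)
        rw [hev.deriv_eq, deriv_const]
  · by_cases hi0 : i = 0
    · -- same as the first case
      rcases hr with hr | hr | hr
      · have hev : cutoff T n τ i =ᶠ[𝓝 t] fun _ => (1 : ℝ) := Eventually.of_forall fun s =>
          cutoff_eq_one hτ (Or.inl hi0) (Or.inl hr)
        rw [hev.deriv_eq, deriv_const]
      · have hev : cutoff T n τ i =ᶠ[𝓝 t] fun _ => (1 : ℝ) := by
          filter_upwards [Iio_mem_nhds hr] with s hs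
          exact cutoff_eq_one hτ (Or.inl hi0) (Or.inr (le_of_lt hs))
        rw [hev.deriv_eq, deriv_const]
      · by_cases hin : i + 1 = n
        · have hev : cutoff T n τ i =ᶠ[𝓝 t] fun _ => (1 : ℝ) := Eventually.of_forall fun s =>
            cutoff_eq_one hτ (Or.inl hi0) (Or.inl hin)
          rw [hev.deriv_eq, deriv_const]
        · have hev : cutoff T n τ i =ᶠ[𝓝 t] fun _ => (0 : ℝ) := by
            filter_upwards [Ioi_mem_nhds hr] with s hs
            exact cutoff_eq_zero_of_ge hτ hin (le_of_lt hs)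
          rw [hev.deriv_eq, deriv_const]
    · have hev : cutoff T n τ i =ᶠ[𝓝 t] fun _ => (0 : ℝ) := by
        filter_upwards [Iio_mem_nhds hl] with s hs
        exact cutoff_eq_zero_of_le hτ hi0 (le_of_lt hs)
      rw [hev.deriv_eq, deriv_const]
  · -- `t` is past the rising window
    rcases hr with hr | hr | hr
    · have hev : cutoff T n τ i =ᶠ[𝓝 t] fun _ => (1 : ℝ) := by
        filter_upwards [Ioi_mem_nhds hl] with s hs
        exact cutoff_eq_one hτ (Or.inr (le_of_lt hs)) (Or.inl hr)
      rw [hev.deriv_eq, deriv_const]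
    · have hev : cutoff T n τ i =ᶠ[𝓝 t] fun _ => (1 : ℝ) := by
        filter_upwards [Ioi_mem_nhds hl, Iio_mem_nhds hr] with s hs hs'
        exact cutoff_eq_one hτ (Or.inr (le_of_lt hs)) (Or.inr (le_of_lt hs'))
      rw [hev.deriv_eq, deriv_const]
    · by_cases hin : i + 1 = n
      · have hev : cutoff T n τ i =ᶠ[𝓝 t] fun _ => (1 : ℝ) := by
          filter_upwards [Ioi_mem_nhds hl] with s hs
          exact cutoff_eq_one hτ (Or.inr (le_of_lt hs)) (Or.inl hin)
        rw [hev.deriv_eq, deriv_const]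
      · have hev : cutoff T n τ i =ᶠ[𝓝 t] fun _ => (0 : ℝ) := by
          filter_upwards [Ioi_mem_nhds hr] with s hs
          exact cutoff_eq_zero_of_ge hτ hin (le_of_lt hs)
        rw [hev.deriv_eq, deriv_const]

/-- **Disjoint supports**: for `i < j`, `χᵢ χⱼ ≡ 0` (the support of `χᵢ` ends at
`tᵢ₊₁ - τ/2 ≤ tⱼ - τ/2` and that of `χⱼ` starts at `tⱼ + τ/2`). [folklore] -/
theorem cutoff_mul_cutoff_eq_zero (hT : 0 ≤ T) (hτ : 0 < τ) {i j : ℕ} (hij : i < j) (hj : j < n)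
    (t : ℝ) : cutoff T n τ i t * cutoff T n τ j t = 0 := by
  rcases le_or_gt t (node T n j + τ / 2) with ht | ht
  · rw [cutoff_eq_zero_of_le hτ (Nat.ne_zero_of_lt hij) ht, mul_zero]
  · have hin : i + 1 ≠ n := by omega
    have hle : node T n (i + 1) - τ / 2 ≤ t := by
      have h1 : node T n (i + 1) ≤ node T n j := node_mono hT n hij
      linarith
    rw [cutoff_eq_zero_of_ge hτ hin hle, zero_mul]

/-- For distinct indices below `n`, `χᵢ χⱼ ≡ 0`. [folklore] -/
theorem cutoff_mul_cutoff_eq_zero_of_ne (hT : 0 ≤ T) (hτ : 0 < τ) {i j : ℕ} (hij : i ≠ j)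
    (hi : i < n) (hj : j < n) (t : ℝ) : cutoff T n τ i t * cutoff T n τ j t = 0 := by
  rcases lt_or_gt_of_ne hij with h | h
  · exact cutoff_mul_cutoff_eq_zero hT hτ h hj t
  · rw [mul_comm]; exact cutoff_mul_cutoff_eq_zero hT hτ h hi t

/-- **At most one cut-off is non-zero at any time**, hence `∑ᵢ χᵢ(t) ≤ 1`. [folklore] -/
theorem sum_cutoff_le_one (hT : 0 ≤ T) (hτ : 0 < τ) (t : ℝ) :
    ∑ i ∈ Finset.range n, cutoff T n τ i t ≤ 1 := by
  by_cases h : ∃ i ∈ Finset.range n, cutoff T n τ i t ≠ 0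
  · obtain ⟨i, hi, hne⟩ := h
    rw [Finset.sum_eq_single_of_mem i hi fun j hj hji => ?_]
    · exact cutoff_le_one T n τ i t
    · have := cutoff_mul_cutoff_eq_zero_of_ne hT hτ hji (Finset.mem_range.1 hj) (Finset.mem_range.1 hi) t
      rcases mul_eq_zero.1 this with h0 | h0
      · exact h0
      · exact absurd h0 hne
  · push Not at h
    rw [Finset.sum_eq_zero h]
    exact zero_le_one

/-- `0 ≤ ∑ᵢ χᵢ`. [folklore] -/
theorem sum_cutoff_nonneg (t : ℝ) : 0 ≤ ∑ i ∈ Finset.range n, cutoff T n τ i t :=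
  Finset.sum_nonneg fun i _ => cutoff_nonneg T n τ i t

/-- If `χᵢ(t) = 1` for some `i < n` then `∑ⱼ χⱼ(t) = 1`. [folklore] -/
theorem sum_cutoff_eq_one_of_eq_one (hT : 0 ≤ T) (hτ : 0 < τ) {i : ℕ} (hi : i < n) {t : ℝ}
    (h1 : cutoff T n τ i t = 1) : ∑ j ∈ Finset.range n, cutoff T n τ j t = 1 := by
  rw [Finset.sum_eq_single_of_mem i (Finset.mem_range.2 hi) fun j hj hji => ?_, h1]
  have := cutoff_mul_cutoff_eq_zero_of_ne hT hτ hji (Finset.mem_range.1 hj) hi t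
  rw [h1, mul_one] at this
  exact this

/-- **Localisation**: for `t ∈ [tᵢ, tᵢ₊₁]`, `i < n`, and `j ≠ i`, the cut-off `χⱼ` vanishes on a
neighbourhood of `t`. [folklore] -/
theorem cutoff_eventuallyEq_zero_of_ne (hT : 0 ≤ T) (hτ : 0 < τ) {i j : ℕ} (hi : i < n)
    (hji : j ≠ i) {t : ℝ} (ht : t ∈ Icc (node T n i) (node T n (i + 1))) :
    cutoff T n τ j =ᶠ[𝓝 t] fun _ => (0 : ℝ) := by
  rcases lt_or_gt_of_ne hji with h | h
  · -- `j < i`: `χⱼ = 0` on `(tⱼ₊₁ - τ/2, ∞) ∋ t`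
    have hjn : j + 1 ≠ n := by omega
    have hlt : node T n (j + 1) - τ / 2 < t := by
      have : node T n (j + 1) ≤ node T n i := node_mono hT n h
      linarith [ht.1]
    filter_upwards [Ioi_mem_nhds hlt] with s hs
    exact cutoff_eq_zero_of_ge hτ hjn (le_of_lt hs)
  · -- `i < j`: `χⱼ = 0` on `(-∞, tⱼ + τ/2) ∋ t`
    have hj0 : j ≠ 0 := Nat.ne_zero_of_lt h
    have hlt : t < node T n j + τ / 2 := by
      have : node T n (i + 1) ≤ node T n j := node_mono hT n h
      linarith [ht.2]
    filter_upwards [Iio_mem_nhds hlt] with s hs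
    exact cutoff_eq_zero_of_le hτ hj0 (le_of_lt hs)

/-- Localisation: `χⱼ(t) = 0` for `t ∈ [tᵢ, tᵢ₊₁]`, `j ≠ i`. [folklore] -/
theorem cutoff_eq_zero_of_ne (hT : 0 ≤ T) (hτ : 0 < τ) {i j : ℕ} (hi : i < n)
    (hji : j ≠ i) {t : ℝ} (ht : t ∈ Icc (node T n i) (node T n (i + 1))) : cutoff T n τ j t = 0 :=
  (cutoff_eventuallyEq_zero_of_ne hT hτ hi hji ht).self_of_nhds

/-- Localisation: `χⱼ'(t) = 0` for `t ∈ [tᵢ, tᵢ₊₁]`, `j ≠ i`. [folklore] -/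
theorem deriv_cutoff_eq_zero_of_ne (hT : 0 ≤ T) (hτ : 0 < τ) {i j : ℕ} (hi : i < n)
    (hji : j ≠ i) {t : ℝ} (ht : t ∈ Icc (node T n i) (node T n (i + 1))) :
    deriv (cutoff T n τ j) t = 0 := by
  rw [(cutoff_eventuallyEq_zero_of_ne hT hτ hi hji ht).deriv_eq, deriv_const]

/-- **Every time of `[0, T]` lies in some grid interval** `[tᵢ, tᵢ₊₁]`, `i < n` (`n ≥ 1`). [folklore] -/
theorem exists_mem_Icc_node (hT : 0 < T) (hn : 0 < n) {t : ℝ} (ht : t ∈ Icc 0 T) :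
    ∃ i, i < n ∧ t ∈ Icc (node T n i) (node T n (i + 1)) := by
  have hθ : 0 < T / n := div_pos hT (by exact_mod_cast hn)
  -- `i = min (⌊t / (T/n)⌋₊) (n - 1)`
  set k : ℕ := ⌊t / (T / n)⌋₊ with hk
  by_cases hkn : k < n
  · refine ⟨k, hkn, ?_, ?_⟩
    · unfold node
      have := Nat.floor_le (div_nonneg ht.1 hθ.le)
      rw [← hk] at this
      calc (k : ℝ) * (T / n) ≤ t / (T / n) * (T / n) := mul_le_mul_of_nonneg_right this hθ.le
        _ = t := div_mul_cancel₀ t hθ.ne'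
    · unfold node
      have := Nat.lt_floor_add_one (t / (T / n))
      rw [← hk] at this
      push_cast
      calc t = t / (T / n) * (T / n) := (div_mul_cancel₀ t hθ.ne').symm
        _ ≤ ((k : ℝ) + 1) * (T / n) := mul_le_mul_of_nonneg_right this.le hθ.le
  · refine ⟨n - 1, Nat.sub_lt hn one_pos, ?_, ?_⟩
    · unfold node
      push Not at hkn
      have h1 : ((n - 1 : ℕ) : ℝ) ≤ k := by exact_mod_cast (Nat.sub_le n 1).trans hkn
      have := Nat.floor_le (div_nonneg ht.1 hθ.le)
      rw [← hk] at this
      calc ((n - 1 : ℕ) : ℝ) * (T / n) ≤ k * (T / n) := mul_le_mul_of_nonneg_right h1 hθ.le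
        _ ≤ t / (T / n) * (T / n) := mul_le_mul_of_nonneg_right this hθ.le
        _ = t := div_mul_cancel₀ t hθ.ne'
    · rw [Nat.sub_one_add_one hn.ne', node_self T hn.ne']
      exact ht.2

/-- The cut-off `χᵢ` is an admissible temporal cut-off for `[tᵢ, tᵢ₊₁]` relative to `[0, T]`
(`i < n`). [folklore] -/
theorem isTimeCutoff_cutoff (hτ : 0 < τ) (hn : 0 < n) {i : ℕ} (hi : i < n) :
    IsTimeCutoff (Icc 0 T) (node T n i) (node T n (i + 1)) (cutoff T n τ i) where
  contDiff := contDiff_cutoff T n τ i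
  left := by
    by_cases h : i = 0
    · left; subst h; rw [node_zero]; exact fun t ht => ht.1
    · right
      exact ⟨node T n i + τ / 2, by linarith, fun t ht => cutoff_eq_zero_of_le hτ h ht⟩
  right := by
    by_cases h : i + 1 = n
    · left; rw [h, node_self T hn.ne']; exact fun t ht => ht.2
    · right
      exact ⟨node T n (i + 1) - τ / 2, by linarith, fun t ht => cutoff_eq_zero_of_ge hτ h ht⟩

end Concentration

end Grid

end Torus

end Literature.Analysis.FluidPDE
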